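import Summits.AtomisticToContinuum.BoseEinsteinCondensation.Theorems.BECNudgeWalkWalkGlue
import Summits.AtomisticToContinuum.BoseEinsteinCondensation.Theorems.BECNudgeWalkNudgedCondensation

/-!
# Strategist census for crux `BECNudgeWalk.NudgeRemoval` (stmt-AtomisticToContinuum-14361)

Kernel-checked content of `STRATEGY-CENSUS.md` (crux-strategist seat, 2026-08-17):

* `FlatModeCondensation` — the DIRECT form of the crux: for `a ≠ 0`, every `τ > 0`, small `ρ` and
  all large `N`, for every energy slack `δ > 0` some `δ`-near-minimiser of the UN-nudged Dirichlet
  energy is `(1 − τ)`-condensed in the flat mode (i.e. the Dirichlet ground state has flat-mode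
  depletion `≤ τN`, inf-over-ground-states reading).
* `nudgeRemoval_of_flatModeCondensation : FlatModeCondensation → NudgeRemoval` and
  `flatModeCondensation_of_nudgeRemoval : NudgeRemoval → FlatModeCondensation` (the latter uses the
  PROVED rung `NudgedCondensation_of`, `GroundStateEnergyFinite_holds`, `ScatteringLengthFinite_holds`):
  the crux is EQUIVALENT over the tree to complete flat-mode BEC of the Dirichlet ground state in the
  dilute limit — the hypothesis of the crux (the rung) is a theorem and carries no leverage.
* `FlatSlackCondensation` — the `strengthen` entry S⁺ (Josephson-slack / sub-extensive coercivity form,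
  cf. route BECJosephsonSlackThreshold item `JosephsonSlackCondensation`), with
  `flatModeCondensation_of_slack : FlatSlackCondensation → FlatModeCondensation`.
* `UniformNudgedCondensation` — the `decomposition` entry: uniform condensation of the nudged
  near-minimisers along the whole path `t ∈ (0, s₀]` (what the landed walk produces from
  NudgeGap + CondensateVariance), with `nudgeRemoval_of_uniform` via the landed `removal_of_cond`.
-/

noncomputable section

open MeasureTheory Filter
open scoped ENNReal NNReal

namespace Summit.AtomisticToContinuum.BoseEinsteinCondensation.Cruxes.NudgeRemoval.Strategist

open Literature.MathematicalPhysics.QuantumManyBody.BoseGas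
open Summit.AtomisticToContinuum.BoseEinsteinCondensation.Theses.BECNudgeWalk
open Summit.AtomisticToContinuum.BoseEinsteinCondensation.Cruxes.NudgeRemoval.Birth
open Summit.AtomisticToContinuum.BoseEinsteinCondensation.NudgedCondensationLine (NudgedCondensation_of)

/-- **Direct form of the crux.** For admissible `v` with `a ≠ 0` and every `τ > 0`: at small density
and for all large `N`, for every slack `δ > 0` some `δ`-near-minimiser of the Dirichlet energy has
flat-mode occupation `≥ (1 − τ)N`. (Complete flat-mode BEC of the ground state in the dilute limit,
inf-over-ground-states reading; FALSE at `a = 0`, where the sine mode condenses, hence the guard.) -/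
def FlatModeCondensation : Prop :=
  ∀ v : ℝ → ℝ≥0∞, IsRepulsiveFiniteRange v → scatteringLength v ≠ 0 → ∀ τ : ℝ, 0 < τ →
    ∃ ρ₀ : ℝ, 0 < ρ₀ ∧ ∀ ρ : ℝ, 0 < ρ → ρ < ρ₀ → ∀ᶠ N : ℕ in atTop,
      ∀ δ : ℝ≥0∞, 0 < δ → ∃ Ψ : TrialState N (sideLength ρ N),
        energy v Ψ ≤ groundStateEnergy v N (sideLength ρ N) + δ ∧
        ENNReal.ofReal ((1 - τ) * N) ≤ occupation N (constantMode (sideLength ρ N)) Ψ.ψ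

/-- **Strengthen entry S⁺ (Josephson slack).** Every trial state within `κN/L²` of the ground-state
energy is `(1 − τ)`-condensed in the flat mode (sub-extensive coercivity
`E(Ψ) − E₀ ≥ (κ/L²)·𝟙{depletion > τN}·N`). -/
def FlatSlackCondensation : Prop :=
  ∀ v : ℝ → ℝ≥0∞, IsRepulsiveFiniteRange v → scatteringLength v ≠ 0 → ∀ τ : ℝ, 0 < τ →
    ∃ ρ₀ : ℝ, 0 < ρ₀ ∧ ∀ ρ : ℝ, 0 < ρ → ρ < ρ₀ → ∃ κ : ℝ, 0 < κ ∧ ∀ᶠ N : ℕ in atTop,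
      ∀ Ψ : TrialState N (sideLength ρ N),
        energy v Ψ ≤ groundStateEnergy v N (sideLength ρ N) +
          ENNReal.ofReal (κ * N / sideLength ρ N ^ 2) →
        ENNReal.ofReal ((1 - τ) * N) ≤ occupation N (constantMode (sideLength ρ N)) Ψ.ψ

/-- **Decomposition entry.** Uniform condensation of the NUDGED near-minimisers along the whole
reward path: given the rung at `s₀ = θρa`, for every `t ∈ (0, s₀]` the near-minimisers of
`F_t = energy + t(N − n̂₀)` are `(1 − 2τ)`-condensed. (This is what the landed walk `rewardWalk`
delivers from NudgeGap + CondensateVariance; every split of it by a `t`-window leaves the window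
touching `t = 0⁺` as the whole crux.) -/
def UniformNudgedCondensation : Prop :=
  ∀ v : ℝ → ℝ≥0∞, IsRepulsiveFiniteRange v → ∀ τ : ℝ, 0 < τ →
    ∃ θ ρ₀ : ℝ, 0 < θ ∧ θ ≤ 1 ∧ 0 < ρ₀ ∧ ∀ ρ : ℝ, 0 < ρ → ρ < ρ₀ → ∀ᶠ N : ℕ in atTop,
      let L : ℝ := sideLength ρ N
      let s₀ : ℝ := θ * ρ * (scatteringLength v).toReal
      (⨅ Ψ : TrialState N L, (energy v Ψ +
          ENNReal.ofReal s₀ * ((N : ℝ≥0∞) - occupation N (constantMode L) Ψ.ψ))) ≤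
        groundStateEnergy v N L + ENNReal.ofReal (s₀ * τ * N) →
      ∀ t : ℝ, 0 < t → t ≤ s₀ → ∃ δ : ℝ≥0∞, 0 < δ ∧ ∀ Ψ : TrialState N L,
        energy v Ψ + ENNReal.ofReal t * ((N : ℝ≥0∞) - occupation N (constantMode L) Ψ.ψ) ≤
          (⨅ Φ : TrialState N L, (energy v Φ +
            ENNReal.ofReal t * ((N : ℝ≥0∞) - occupation N (constantMode L) Φ.ψ))) + δ →
        ENNReal.ofReal ((1 - 2 * τ) * N) ≤ occupation N (constantMode L) Ψ.ψ

/-! ## The crux is the direct statement in disguise -/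

/-- `FlatModeCondensation → NudgeRemoval`: test `F_s` on a condensed near-minimiser of the
un-nudged energy (`θ = 1`; the hypothesis of the crux is not used; `a = 0` or `a = ⊤` make
`s₀ = 0`, vacuous). -/
theorem nudgeRemoval_of_flatModeCondensation (h : FlatModeCondensation) : NudgeRemoval := by
  intro v hv τ hτ
  by_cases ha : (scatteringLength v).toReal = 0
  · refine ⟨1, 1, one_pos, le_rfl, one_pos, fun ρ hρ _ => Filter.Eventually.of_forall fun N => ?_⟩
    intro L s₀ R _ s hs hss
    exfalso
    have : s₀ = 0 := by simp [s₀, ha]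
    linarith
  · have ha0 : scatteringLength v ≠ 0 := by
      intro h0; exact ha (by simp [h0])
    obtain ⟨ρ₀, hρ₀, H⟩ := h v hv ha0 τ hτ
    refine ⟨1, ρ₀, one_pos, le_rfl, hρ₀, fun ρ hρ hρlt => ?_⟩
    filter_upwards [H ρ hρ hρlt] with N hN
    intro L s₀ R _ s hs _
    show (⨅ Ψ : TrialState N L, (energy v Ψ +
        ENNReal.ofReal s * ((N : ℝ≥0∞) - occupation N (constantMode L) Ψ.ψ))) ≤
      groundStateEnergy v N L + ENNReal.ofReal (2 * τ * s * N)
    refine ENNReal.le_of_forall_pos_le_add fun ε hε _ => ?_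
    obtain ⟨Ψ, hE, hn⟩ := hN (ε : ℝ≥0∞) (ENNReal.coe_pos.2 hε)
    have hdep : (N : ℝ≥0∞) - occupation N (constantMode L) Ψ.ψ ≤ ENNReal.ofReal (τ * N) :=
      depletion_le_of_level hτ.le hn
    calc (⨅ Ψ : TrialState N L, (energy v Ψ +
          ENNReal.ofReal s * ((N : ℝ≥0∞) - occupation N (constantMode L) Ψ.ψ)))
        ≤ energy v Ψ + ENNReal.ofReal s * ((N : ℝ≥0∞) - occupation N (constantMode L) Ψ.ψ) :=
          iInf_le _ Ψ
      _ ≤ (groundStateEnergy v N L + ε) + ENNReal.ofReal s * ENNReal.ofReal (τ * N) :=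
          add_le_add hE (by gcongr)
      _ = groundStateEnergy v N L + ENNReal.ofReal (τ * s * N) + ε := by
          rw [← ENNReal.ofReal_mul hs.le, show s * (τ * N) = τ * s * N by ring]
          ring
      _ ≤ groundStateEnergy v N L + ENNReal.ofReal (2 * τ * s * N) + ε := by
          gcongr
          nlinarith [N.cast_nonneg (α := ℝ), hs.le, hτ.le]

/-- `NudgeRemoval → FlatModeCondensation` (uses the PROVED rung `NudgedCondensation_of` and the
closed supports `GroundStateEnergyFinite_holds`, `ScatteringLengthFinite_holds`): from
`R(s) ≤ E₀ + 2(τ/3)sN` at a small reward `s` a near-minimiser of `F_s` is a `δ`-near-minimiser of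
the energy with flat-mode depletion `≤ τN`. -/
theorem flatModeCondensation_of_nudgeRemoval (h : NudgeRemoval) : FlatModeCondensation := by
  intro v hv ha0 τ hτ
  have hτ₁ : (0 : ℝ) < τ / 3 := by positivity
  obtain ⟨θ, ρ₁, hθ, -, hρ₁, Hrem⟩ := h v hv (τ / 3) hτ₁
  obtain ⟨ρ₂, hρ₂, Hrung⟩ := NudgedCondensation_of v hv (τ / 3) θ hτ₁ hθ
  obtain ⟨ρ₃, hρ₃, Hfin⟩ := GroundStateEnergyFinite_holds v hv
  have hatop : scatteringLength v ≠ ⊤ := ScatteringLengthFinite_holds v hv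
  have ha : 0 < (scatteringLength v).toReal := ENNReal.toReal_pos ha0 hatop
  refine ⟨min ρ₁ (min ρ₂ ρ₃), by positivity, fun ρ hρ hρlt => ?_⟩
  have h1 : ρ < ρ₁ := lt_of_lt_of_le hρlt (min_le_left _ _)
  have h2 : ρ < ρ₂ := lt_of_lt_of_le hρlt ((min_le_right _ _).trans (min_le_left _ _))
  have h3 : ρ < ρ₃ := lt_of_lt_of_le hρlt ((min_le_right _ _).trans (min_le_right _ _))
  filter_upwards [Hrem ρ hρ h1, Hrung ρ hρ h2, Hfin ρ hρ h3, eventually_gt_atTop 0]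
    with N hrem hrung hfin hNpos
  intro δ hδ
  set L : ℝ := sideLength ρ N with hL
  set E₀ := groundStateEnergy v N L with hE₀
  set s₀ : ℝ := θ * ρ * (scatteringLength v).toReal with hs₀def
  have hs₀ : 0 < s₀ := by positivity
  have hNr : (0 : ℝ) < N := Nat.cast_pos.2 hNpos
  -- the removal conclusion at every `s ∈ (0, s₀]`
  have Hall : ∀ s : ℝ, 0 < s → s ≤ s₀ →
      (⨅ Ψ : TrialState N L, (energy v Ψ +
        ENNReal.ofReal s * ((N : ℝ≥0∞) - occupation N (constantMode L) Ψ.ψ))) ≤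
        E₀ + ENNReal.ofReal (2 * (τ / 3) * s * N) := hrem hrung
  -- a finite slack `δ₁ ≤ δ`
  set δ₁ : ℝ≥0∞ := min δ 1 with hδ₁
  have hδ₁pos : 0 < δ₁ := lt_min hδ one_pos
  have hδ₁top : δ₁ ≠ ⊤ := ne_top_of_le_ne_top ENNReal.one_ne_top (min_le_right _ _)
  have hδ₁le : δ₁ ≤ δ := min_le_left _ _
  set d : ℝ := δ₁.toReal with hd
  have hdpos : 0 < d := ENNReal.toReal_pos hδ₁pos.ne' hδ₁top
  -- the reward `s ≤ s₀` with `τ s N ≤ d`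
  set s : ℝ := min s₀ (d / (τ * N)) with hsdef
  have hspos : 0 < s := lt_min hs₀ (by positivity)
  have hss₀ : s ≤ s₀ := min_le_left _ _
  have hsN : τ * s * N ≤ d := by
    have : s ≤ d / (τ * N) := min_le_right _ _
    calc τ * s * N ≤ τ * (d / (τ * N)) * N := by gcongr
      _ = d := by field_simp
  have hR := Hall s hspos hss₀
  have hRne : (⨅ Ψ : TrialState N L, (energy v Ψ +
      ENNReal.ofReal s * ((N : ℝ≥0∞) - occupation N (constantMode L) Ψ.ψ))) ≠ ⊤ :=
    ne_top_of_le_ne_top (ENNReal.add_ne_top.2 ⟨hfin, ENNReal.ofReal_ne_top⟩) hR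
  have hslack : 0 < ENNReal.ofReal (τ / 3 * s * N) := ENNReal.ofReal_pos.2 (by positivity)
  obtain ⟨Ψ, hΨ⟩ := exists_le_iInf_add _ hRne hslack
  set n₀ := occupation N (constantMode L) Ψ.ψ with hn₀
  have hsum : ENNReal.ofReal (2 * (τ / 3) * s * N) + ENNReal.ofReal (τ / 3 * s * N) =
      ENNReal.ofReal (τ * s * N) := by
    rw [← ENNReal.ofReal_add (by positivity) (by positivity)]; congr 1; ring
  have hF : energy v Ψ + ENNReal.ofReal s * ((N : ℝ≥0∞) - n₀) ≤ E₀ + ENNReal.ofReal (τ * s * N) := by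
    calc energy v Ψ + ENNReal.ofReal s * ((N : ℝ≥0∞) - n₀)
        ≤ _ := hΨ
      _ ≤ (E₀ + ENNReal.ofReal (2 * (τ / 3) * s * N)) + ENNReal.ofReal (τ / 3 * s * N) := by
          gcongr
      _ = E₀ + ENNReal.ofReal (τ * s * N) := by rw [add_assoc, hsum]
  refine ⟨Ψ, ?_, ?_⟩
  · -- energy slack
    calc energy v Ψ ≤ energy v Ψ + ENNReal.ofReal s * ((N : ℝ≥0∞) - n₀) := le_self_add
      _ ≤ E₀ + ENNReal.ofReal (τ * s * N) := hF
      _ ≤ E₀ + δ₁ := by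
          gcongr
          calc ENNReal.ofReal (τ * s * N) ≤ ENNReal.ofReal d := ENNReal.ofReal_le_ofReal hsN
            _ = δ₁ := ENNReal.ofReal_toReal hδ₁top
      _ ≤ E₀ + δ := by gcongr
  · -- flat-mode level
    have h2 : E₀ ≤ energy v Ψ := groundStateEnergy_le_energy v Ψ
    have h3 : E₀ + ENNReal.ofReal s * ((N : ℝ≥0∞) - n₀) ≤ E₀ + ENNReal.ofReal (τ * s * N) :=
      le_trans (by gcongr) hF
    have h4 : ENNReal.ofReal s * ((N : ℝ≥0∞) - n₀) ≤ ENNReal.ofReal (τ * s * N) :=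
      (ENNReal.add_le_add_iff_left hfin).1 h3
    have h5 : ENNReal.ofReal (τ * s * N) = ENNReal.ofReal s * ENNReal.ofReal (τ * N) := by
      rw [← ENNReal.ofReal_mul hspos.le]; congr 1; ring
    rw [h5] at h4
    have h6 : ((N : ℝ≥0∞) - n₀) ≤ ENNReal.ofReal (τ * N) := by
      have hs0 : ENNReal.ofReal s ≠ 0 := (ENNReal.ofReal_pos.2 hspos).ne'
      exact (ENNReal.mul_le_mul_iff_right hs0 ENNReal.ofReal_ne_top).1 h4
    exact level_of_depletion_le hτ.le h6

/-- S⁺ ⟹ the direct form: a near-minimiser within `min δ (κN/L²)` of `E₀` exists (`E₀ < ⊤`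
eventually, `GroundStateEnergyFinite_holds`) and is condensed by S⁺. -/
theorem flatModeCondensation_of_slack (h : FlatSlackCondensation) : FlatModeCondensation := by
  intro v hv ha0 τ hτ
  obtain ⟨ρ₁, hρ₁, H⟩ := h v hv ha0 τ hτ
  obtain ⟨ρ₃, hρ₃, Hfin⟩ := GroundStateEnergyFinite_holds v hv
  refine ⟨min ρ₁ ρ₃, by positivity, fun ρ hρ hρlt => ?_⟩
  have h1 : ρ < ρ₁ := lt_of_lt_of_le hρlt (min_le_left _ _)
  have h3 : ρ < ρ₃ := lt_of_lt_of_le hρlt (min_le_right _ _)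
  obtain ⟨κ, hκ, Hκ⟩ := H ρ hρ h1
  filter_upwards [Hκ, Hfin ρ hρ h3, eventually_gt_atTop 0] with N hN hfin hNpos
  intro δ hδ
  have hL : 0 < sideLength ρ N := by
    unfold sideLength; exact Real.rpow_pos_of_pos (by positivity) _
  set δ' : ℝ≥0∞ := min δ (ENNReal.ofReal (κ * N / sideLength ρ N ^ 2)) with hδ'
  have hδ'pos : 0 < δ' := lt_min hδ (ENNReal.ofReal_pos.2 (by positivity))
  obtain ⟨Ψ, hΨ⟩ := exists_le_iInf_add (fun Φ : TrialState N (sideLength ρ N) => energy v Φ)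
    (by simpa [groundStateEnergy] using hfin) hδ'pos
  have hΨ' : energy v Ψ ≤ groundStateEnergy v N (sideLength ρ N) + δ' := hΨ
  refine ⟨Ψ, ?_, hN Ψ ?_⟩
  · exact hΨ'.trans (add_le_add le_rfl (min_le_left _ _))
  · exact hΨ'.trans (add_le_add le_rfl (min_le_right _ _))

/-- The decomposition entry closes the crux through the landed W3 (`removal_of_cond`). -/
theorem nudgeRemoval_of_uniform (h : UniformNudgedCondensation) : NudgeRemoval := by
  intro v hv τ hτ
  obtain ⟨θ, ρ₁, hθ, hθ1, hρ₁, H⟩ := h v hv τ hτ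
  obtain ⟨ρ₃, hρ₃, Hfin⟩ := GroundStateEnergyFinite_holds v hv
  refine ⟨θ, min ρ₁ ρ₃, hθ, hθ1, by positivity, fun ρ hρ hρlt => ?_⟩
  have h1 : ρ < ρ₁ := lt_of_lt_of_le hρlt (min_le_left _ _)
  have h3 : ρ < ρ₃ := lt_of_lt_of_le hρlt (min_le_right _ _)
  filter_upwards [H ρ hρ h1, Hfin ρ hρ h3, eventually_gt_atTop 0] with N hN hfin hNpos
  intro L s₀ R hrung s hs hss
  have hcond := hN hrung
  have key := removal_of_cond v hs hss (by positivity : (0 : ℝ) ≤ 2 * τ) hNpos hfin hcond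
  simpa [mul_comm, mul_assoc, mul_left_comm] using key

end Summit.AtomisticToContinuum.BoseEinsteinCondensation.Cruxes.NudgeRemoval.Strategist

end
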